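/-
Copyright (c) 2026 the pub-hodgecm-mathlib formalisation cell (harness21).  Prover seat hodgecm-mathlib-K2Liu-p26 (g3), Track B «K2-LIT»,
#184♮ = hLiu418 = `stmt-HodgeConjecture-24832`; socket #41 `sig_K2LiuSiegelEisensteinContinuation`, KIND W, brick (KW-fin-size) (V) `hvol_of_haar`
(LEAD F0P6-plan (g15) BATCH #197 (2), KW desk F0P2-p08 (g3)): the HAAR-VOLUME LETTER of the balls `kindWLocalBall v (π v) (−a)` for the KIND-W carriers of
record — the by-value input `(Tν ρν hρν dν hvol)` of ★ p863720 `K2LiuKindWFiniteSizeLetterOfPlace.hsizeLoc_of_place`, PAID for every Haar family normalised by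
`νv v (N_Δ ∩ K_v) = 1`.  THEOREMS ONLY (no `def`, no `instance`, no notation, no named-fact hypothesis, no `sorry`).
-/
import Summits.HodgeConjecture.HodgeConjecture.Theorems.K2LiuKindWFiniteLetterHolomorphic     -- ★ (K2E3-p29∕p37) chart lemmas `kindWLocalBall_eq_preimage`, `skewCarrier_measure_letters` (⊇ ★ p863154 `kindWLocalBall`, ★ B2, ★ B1)
import Summits.HodgeConjecture.HodgeConjecture.Theorems.K2LiuBadPlaceWhittakerSkewInstance     -- ★ (K2Liu-p26 (g0)) `prod_inv_normAbs_ne_top` (⊇ ★ U3 `K2LiuSkewBallVolumeGrowth.measure_ball_sub_le_pow_mul`, ★ F3b)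
import Summits.HodgeConjecture.HodgeConjecture.Theorems.K2LiuGoodPlaceWhittakerProductBound    -- ★ R2 `toReal_prod_inv_normAbs_toPlace_pow` (the dictionary `N_v^K = q_v^{2n²K}`)
import Summits.HodgeConjecture.HodgeConjecture.Theorems.K2LiuKindOneLineGoodPlaceLetters       -- ★ `exists_finset_forall_valuation_two_eq_one` (`|2|_w = 1` off a finite set)
import Summits.HodgeConjecture.HodgeConjecture.Theorems.K2LiuKindWFinitePartLettersOfRecord   -- ★ p863047 `mem_biUnion_placesOver_iff` (the fibre Finset `T′ = ⋃_{v ∈ T} {w ∣ v}`)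
import HarnessLib

/-!
# Crux `HLiu418`, socket #41, KIND W — brick (KW-fin-size) (V) `K2LiuKindWCarrierHaarVolume :: hvol_of_haar`: THE HAAR VOLUME OF THE BALLS
# `νv v (kindWLocalBall v ϖ (−a)) ≤ (∏_{w∣v} N(𝔭_w)^{ρν w}) · N(v)^{2n²·a}` FOR EVERY HAAR FAMILY WITH `νv v (N_Δ ∩ K_v) = 1`

Cell `hodgecm-mathlib`, crux item hLiu418 = `stmt-HodgeConjecture-24832` (helper lane `--supports … --as helper`, count-neutral), route of record
`HCCMUnconditional`; squad K2 ∕ K2Liu, road `K2_Liu`, socket #41, KIND W; LEAD F0P6-plan (g15) BATCH #197 (2), KW desk F0P2-p08 (g3).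

THE SLOT.  ★ p863720 `K2LiuKindWFiniteSizeLetterOfPlace.hsizeLoc_of_place` takes BY VALUE `(Tν : Finset 𝔭_L) (ρν : 𝔭_L → ℕ) (hρν : ∀ w ∉ Tν, ρν w = 0) (dν : ℕ)
(hvol : ∀ v a, νv v (kindWLocalBall L e dV hdV dW hdW v (π v) (−a)) ≤ ENNReal.ofReal ((∏_{w∣v} N(𝔭_w)^{ρν w}) · N(v)^{dν·a}))`; at the tie the carriers `νv` are the
∃-bound Haar measures of ★ `kindW_block_cm_of_localLetters_haar` with their normalisation `hνK : ∀ v, νv v (inH localInt unipDeltaLoc v) = 1` (★ p862988 ∕ ★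
`exists_kindW_carrierLetters_haar`).  THIS FILE pays the whole letter for EVERY such family, with `dν := 2·n²`:
* §1 (one place) **`measure_kindWLocalBall_neg_le`** `νv(B(−a)) ≤ N(v)^{2n²a} · νv(B(0))` — the ★ B2 chart `ψc : N_Δ(L⁺_v) ≃ₜ Skew` (★ `exists_homeomorph_skew_of_carrier`,
  ★ B1 `mem_unipDeltaLoc_iff_mem_unipDeltaLocal`, ★ `skewCarrier_measure_letters`, ★ `kindWLocalBall_eq_preimage`) carries `νv v` to an additive Haar measure on the Skew
  carrier and the balls to ★ F3b's balls; there ★ U3 `K2LiuSkewBallVolumeGrowth.measure_ball_sub_le_pow_mul` gives `μ(B(−a)) ≤ N_v^a · μ(B(0))` with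
  `N_v = ∏_{(i,j,w)} |ι_w π|_w⁻¹`, and ★ R2 `toReal_prod_inv_normAbs_toPlace_pow` reads `N_v^a = q_v^{2n²a}` (`q_v = N(v)`, `L ∕ L⁺` quadratic); `measure_kindWLocalBall_ne_top`;
* §2 (one place) **`measure_kindWLocalBall_zero_eq`** — at `|2|_w = 1` (`∀ w ∣ v`), `νv(B(0)) = νv(N_Δ ∩ K_v)` (★ B2 `map_apply_ball_zero_eq`; the set `{u | ↑u ∈ K_v}` IS
  `inH localInt unipDeltaLoc v`), so `= 1` under `hνK`;
* §3 **`hvol_of_haar`** — the letter: `Tν := ⋃_{v ∈ T₂} {w ∣ v}` for the finite set `T₂` of places with some `|2|_w ≠ 1` (★ `exists_finset_forall_valuation_two_eq_one`),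
  `ρν w := ⌈(νv v (B(0))).toReal⌉₊` above `v ∈ T₂` (so that `N(𝔭_w)^{ρν w} ≥ 2^{ρν w} > νv v (B(0))`, ★ `two_le_absNorm`), `0` elsewhere; `dν := 2·n²`.
[Weil1965, §37], [WeilBNT1967, Ch. I §2, Ch. II §4], [Casselman1980, §3], [Tan1999, §2], [HarrisKudlaSweet1996, §1 (1.11)–(1.12)], [CasselsFrohlichANT1967, Ch. II §11].
HONEST LABEL.  Count-neutral helper; closes no socket by itself: `HC_CM` is proved only modulo the 7 printed citations (2 remaining named inputs:
hLiu418 = `stmt-HodgeConjecture-24832`, h413 = `stmt-HodgeConjecture-24833`) until rung 0 closes.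
-/

set_option autoImplicit false
-- the mandated namespace repeats the single-problem summit's segment (`HodgeConjecture.HodgeConjecture`)
set_option linter.dupNamespace false

noncomputable section

open scoped Matrix RestrictedProduct ENNReal NNReal Topology BigOperators
-- `Classical`: the `Finset` of bad places and the `if` in `ρν` (as ★ p863047 ∕ ★ p863720)
open scoped Classical
open NumberField IsDedekindDomain Matrix MeasureTheory Measure Filter Set

namespace Summit.HodgeConjecture.HodgeConjecture.Cruxes.HLiu418.K2LiuKindWCarrierHaarVolume

open Literature.NumberTheory.Automorphic Literature.NumberTheory.Automorphic.UnitaryGroup Literature.NumberTheory.GaloisRepresentations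
open Literature.NumberTheory.GelbartRogawski1991 Literature.NumberTheory.GelbartRogawski1991.GRConstruction
open Literature.NumberTheory.GelbartRogawski1991.AdaptedBlocks
open Literature.NumberTheory.GelbartRogawski1991.UnitaryDualPair
open Literature.NumberTheory.K2Lit Literature.NumberTheory.K2Lit.SiegelDoubled Literature.NumberTheory.K2Lit.LocalSiegelDoubled Literature.NumberTheory.K2Lit.PlaceSplitting
open Literature.NumberTheory.GaloisRepresentations.IsNonarchimedeanLocalField (normAbs)
open Literature.MeasureTheory.RestrictedProduct
open Literature.Topology.Algebra.RestrictedProduct (inH)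
open Summit.HodgeConjecture.HodgeConjecture.Cruxes.HLiu418.K2LiuSiegelUnipotentLocalDefs
open Summit.HodgeConjecture.HodgeConjecture.Cruxes.HLiu418.K2LiuSiegelUnipotentFourierDefs
open Summit.HodgeConjecture.HodgeConjecture.Cruxes.HLiu418.K2LiuUnipDeltaLocBridge
open Summit.HodgeConjecture.HodgeConjecture.Cruxes.HLiu418.K2LiuUnipDeltaLocalHaarTransport
open Summit.HodgeConjecture.HodgeConjecture.Cruxes.HLiu418.K2LiuKindWFiniteLetterDefs (kindWLocalBall mem_kindWLocalBall_iff)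
open Summit.HodgeConjecture.HodgeConjecture.Cruxes.HLiu418.K2LiuKindWFiniteLetterHolomorphic (kindWLocalBall_eq_preimage skewCarrier_measure_letters)
open Summit.HodgeConjecture.HodgeConjecture.Cruxes.HLiu418.K2LiuKindOneLineGoodPlaceLetters (exists_finset_forall_valuation_two_eq_one)
open Summit.HodgeConjecture.HodgeConjecture.Cruxes.HLiu418.K2LiuKindWFinitePartLettersOfRecord (mem_biUnion_placesOver_iff)
open Summit.HodgeConjecture.HodgeConjecture.Cruxes.HLiu418.K2LiuSiegelEisensteinKindWInstance (two_le_absNorm)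

variable (L : Type) [Field L] [NumberField L] [IsCMField L]
variable {N M n : ℕ} (e : Fin N × Fin M ≃ Fin n)
  (dV : Fin N → L) (hdV : ∀ i, IsCMField.complexConj L (dV i) = dV i)
  (dW : Fin M → L) (hdW : ∀ i, IsCMField.complexConj L (dW i) = dW i)
/-! ## §1 One place: the growth `νv(B(−a)) ≤ N(v)^{2n²a} · νv(B(0))` through the Skew chart -/

section OnePlace

variable (v : HeightOneSpectrum (𝓞 (Fp L))) {π : v.adicCompletion (Fp L)} (hπ : Valued.v π = WithZero.exp (-1 : ℤ))
  [MeasurableSpace ↥(unipDeltaLoc L e dV hdV dW hdW v)] [BorelSpace ↥(unipDeltaLoc L e dV hdV dW hdW v)]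
  (ν : Measure ↥(unipDeltaLoc L e dV hdV dW hdW v)) [ν.IsHaarMeasure]

include hπ in
set_option synthInstance.maxHeartbeats 200000 in -- the `OpensMeasurableSpace ↥(unipDeltaLoc …)` instance behind `ψc.measurable` (CM subgroup telescope; as ★ `K2LiuA7ValueUnipotentLaw`)
set_option maxHeartbeats 800000 in -- MEASURED: 400 000 ✗ (`whnf`∕`isDefEq` of the ★ B2 chart heads in the CM frame telescope) ∕ 800 000 ✓ (class of ★ `K2LiuKindWFiniteLetterHolomorphic.skewCarrier_measure_letters`); scoped to this decl, plain `obtain`∕`rw`∕`exact`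
/-- **THE CHART, ONCE**: the Skew carrier `Sk = Skew_{gramR}(L ⊗ L⁺_v)` with its Borel σ-algebra, the ★ B2 chart `ψc : N_Δ(L⁺_v) ≃ₜ Sk` (`(ψc u).1 = B(matA u)`), the transported
measure `ψc_*ν` an additive Haar measure on `Sk`, and the two facts read through it: the ball volumes `ν(B(b)) = (ψc_*ν)(B_{Sk}(b))` for every `b`, hence
(i) `ν(B(−a)) ≤ N_v^a · ν(B(0))` (★ U3) and (ii) `ν(B(b)) < ∞` (★ F3b).  Stated as the two consequences (no chart escapes). [cite: Weil1965, §37] [cite: WeilBNT1967, Ch. II §4] -/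
theorem measure_kindWLocalBall_letters (a : ℕ) (b : ℤ) :
    ν (kindWLocalBall L e dV hdV dW hdW v π (-(a : ℤ))) ≤
        (∏ p : Fin n × Fin n × UnitaryGroup.PlacesOver L v,
            ((normAbs (p.2.2.1.adicCompletion L) (UnitaryGroup.toPlace v p.2.2 π) : ℝ≥0∞))⁻¹) ^ a * ν (kindWLocalBall L e dV hdV dW hdW v π 0) ∧
      ν (kindWLocalBall L e dV hdV dW hdW v π b) ≠ ∞ := by
  haveI : Algebra.IsQuadraticExtension (Fp L) L := IsCMField.isQuadraticExtension L
  -- the Skew carrier of ★ B2 at `T₀ := gramR`, its Borel structure, the chart and the transported Haar measure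
  set Sk : AddSubgroup (Matrix (Fin n) (Fin n) (LocalRing L v)) :=
    skewMatrices (conjLocal L (IsCMField.complexConj L) v) (LocalSplitting.gramS (Fp L) L v n (gramR L e dV hdV dW hdW)) with hSkdef
  have hSk : ∀ t, t ∈ Sk ↔ (t.map (conjLocal L (IsCMField.complexConj L) v))ᵀ * LocalSplitting.gramS (Fp L) L v n (gramR L e dV hdV dW hdW) +
      LocalSplitting.gramS (Fp L) L v n (gramR L e dV hdV dW hdW) * t = 0 :=
    fun t => (mem_skewMatrices_iff _ _ t).trans (by rw [add_comm])
  letI : MeasurableSpace ↥Sk := borel _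
  haveI : BorelSpace ↥Sk := ⟨rfl⟩
  obtain ⟨ψc, hψc, -⟩ := exists_homeomorph_skew_of_carrier (F := Fp L) (E := L) (c := IsCMField.complexConj L) (v := v) (n := n)
    (hJD := hermD_eq_map_gramD L e dV hdV dW hdW) (N' := unipDeltaLoc L e dV hdV dW hdW v) (hN' := mem_unipDeltaLoc_iff_mem_unipDeltaLocal L e dV hdV dW hdW v)
    (S := Sk) (hS := hSk)
  obtain ⟨hHaar, -, -⟩ := skewCarrier_measure_letters L e dV hdV dW hdW v Sk hSk ψc hψc ν
  haveI := hHaar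
  have hψm : Measurable ψc := ψc.measurable
  have hball : ∀ b' : ℤ, ν (kindWLocalBall L e dV hdV dW hdW v π b') =
      Measure.map ψc ν {t : Sk | ∀ i j (w : UnitaryGroup.PlacesOver L v), Valued.v (t.1 i j w) ≤ Valued.v (UnitaryGroup.toPlace v w π) ^ b'} := fun b' => by
    rw [kindWLocalBall_eq_preimage L e dV hdV dW hdW v Sk ψc hψc π b', Measure.map_apply hψm (K2LiuSkewLatticeShells.measurableSet_ball (Fp L) L v hπ n Sk b')]
  refine ⟨?_, ?_⟩
  · have hU3 := K2LiuSkewBallVolumeGrowth.measure_ball_sub_le_pow_mul (Fp L) L (IsCMField.complexConj L) v hπ n Sk hSk (Measure.map ψc ν) 0 a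
    rw [show ((0 : ℤ) - (a : ℕ) : ℤ) = -(a : ℤ) by simp] at hU3
    rw [hball, hball]
    exact hU3
  · rw [hball]
    exact K2LiuSkewLatticeShells.measure_ball_ne_top (Fp L) L (IsCMField.complexConj L) v hπ n Sk hSk (Measure.map ψc ν) b

include hπ in
/-- **THE DICTIONARY IN `ℝ≥0∞`**: `N_v^a = q_v^{2n²a}` with `q_v = N(v)` (★ R2 `toReal_prod_inv_normAbs_toPlace_pow` — `∏_{w∣v} ‖ι_w π‖_w = q_v⁻²` for the quadratic `L ∕ L⁺` — read back
through `ofReal ∘ toReal`, ★ `prod_inv_normAbs_ne_top`; ★ `residueCard = absNorm`). [cite: CasselsFrohlichANT1967, Ch. II §11] -/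
theorem prod_inv_normAbs_pow_eq_ofReal (a : ℕ) :
    (∏ p : Fin n × Fin n × UnitaryGroup.PlacesOver L v, ((normAbs (p.2.2.1.adicCompletion L) (UnitaryGroup.toPlace v p.2.2 π) : ℝ≥0∞))⁻¹) ^ a =
      ENNReal.ofReal (((Ideal.absNorm v.asIdeal : ℕ) : ℝ) ^ (2 * (n * n) * a)) := by
  haveI : Algebra.IsQuadraticExtension (Fp L) L := IsCMField.isQuadraticExtension L
  rw [← ENNReal.ofReal_toReal (ENNReal.pow_ne_top (K2LiuBadPlaceWhittakerSkewInstance.prod_inv_normAbs_ne_top (Fp L) L v hπ n)),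
    K2LiuGoodPlaceWhittakerProductBound.toReal_prod_inv_normAbs_toPlace_pow (Fp L) L v hπ n a]
  rfl

include hπ in
/-- **(V) AT ONE PLACE, BEFORE NORMALISATION**: `νv v (kindWLocalBall v π (−a)) ≤ N(v)^{2n²a} · νv v (kindWLocalBall v π 0)` for every Haar `νv v`.
[cite: WeilBNT1967, Ch. II §4] [cite: Weil1965, §37] -/
theorem measure_kindWLocalBall_neg_le (a : ℕ) :
    ν (kindWLocalBall L e dV hdV dW hdW v π (-(a : ℤ))) ≤
      ENNReal.ofReal (((Ideal.absNorm v.asIdeal : ℕ) : ℝ) ^ (2 * (n * n) * a)) * ν (kindWLocalBall L e dV hdV dW hdW v π 0) := by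
  rw [← prod_inv_normAbs_pow_eq_ofReal L v hπ a]
  exact (measure_kindWLocalBall_letters L e dV hdV dW hdW v hπ ν a 0).1

include hπ in
/-- the balls have finite Haar measure (compact under the chart, ★ F3b `measure_ball_ne_top`). [folklore] -/
theorem measure_kindWLocalBall_ne_top (b : ℤ) : ν (kindWLocalBall L e dV hdV dW hdW v π b) ≠ ∞ :=
  (measure_kindWLocalBall_letters L e dV hdV dW hdW v hπ ν 0 b).2

/-! ## §2 One place with `|2|_w = 1`: `νv(B(0)) = νv(N_Δ ∩ K_v)` -/

omit [ν.IsHaarMeasure] in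
include hπ in
set_option synthInstance.maxHeartbeats 200000 in -- as above (`ψc.measurable`)
set_option maxHeartbeats 800000 in -- MEASURED: 400 000 ✗ (`whnf`∕`isDefEq` of the ★ B2 chart heads in the CM frame telescope) ∕ 800 000 ✓ (class of ★ `K2LiuKindWFiniteLetterHolomorphic.skewCarrier_measure_letters`); scoped to this decl, plain `obtain`∕`rw`∕`exact`
/-- **NORMALISATION**: at a place with `|2|_w = 1` for all `w ∣ v`, `νv v (kindWLocalBall v π 0) = νv v (inH localInt unipDeltaLoc v)` — ★ B2 `map_apply_ball_zero_eq`
(`n(t) ∈ K_v ⟺ t` integral, ★ `mem_localInt_iff_isIntegralAt_blkB`) through the chart; the set `{u | ↑u ∈ K_v}` is the subgroup `inH localInt unipDeltaLoc v` of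
★ `RestrictedProduct.Cutout` (`Subgroup.subgroupOf`, definitional). [cite: Casselman1980, §3] [cite: Tan1999, §2] -/
theorem measure_kindWLocalBall_zero_eq
    (h2 : ∀ w : UnitaryGroup.PlacesOver L v, ValuativeRel.valuation (w.1.adicCompletion L) (2 : w.1.adicCompletion L) = 1) :
    ν (kindWLocalBall L e dV hdV dW hdW v π 0) =
      ν (((inH (fun v => UnitaryGroup.localInt L (IsCMField.complexConj L) (n + n) (hermD L e dV hdV dW hdW) v)
        (fun v => unipDeltaLoc L e dV hdV dW hdW v) v) : Subgroup (unipDeltaLoc L e dV hdV dW hdW v)) : Set (unipDeltaLoc L e dV hdV dW hdW v)) := by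
  haveI : Algebra.IsQuadraticExtension (Fp L) L := IsCMField.isQuadraticExtension L
  set Sk : AddSubgroup (Matrix (Fin n) (Fin n) (LocalRing L v)) :=
    skewMatrices (conjLocal L (IsCMField.complexConj L) v) (LocalSplitting.gramS (Fp L) L v n (gramR L e dV hdV dW hdW)) with hSkdef
  have hSk : ∀ t, t ∈ Sk ↔ (t.map (conjLocal L (IsCMField.complexConj L) v))ᵀ * LocalSplitting.gramS (Fp L) L v n (gramR L e dV hdV dW hdW) +
      LocalSplitting.gramS (Fp L) L v n (gramR L e dV hdV dW hdW) * t = 0 :=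
    fun t => (mem_skewMatrices_iff _ _ t).trans (by rw [add_comm])
  letI : MeasurableSpace ↥Sk := borel _
  haveI : BorelSpace ↥Sk := ⟨rfl⟩
  obtain ⟨ψc, hψc, -⟩ := exists_homeomorph_skew_of_carrier (F := Fp L) (E := L) (c := IsCMField.complexConj L) (v := v) (n := n)
    (hJD := hermD_eq_map_gramD L e dV hdV dW hdW) (N' := unipDeltaLoc L e dV hdV dW hdW v) (hN' := mem_unipDeltaLoc_iff_mem_unipDeltaLocal L e dV hdV dW hdW v)
    (S := Sk) (hS := hSk)
  have hψm : Measurable ψc := ψc.measurable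
  rw [kindWLocalBall_eq_preimage L e dV hdV dW hdW v Sk ψc hψc π 0, ← Measure.map_apply hψm (K2LiuSkewLatticeShells.measurableSet_ball (Fp L) L v hπ n Sk 0),
    map_apply_ball_zero_eq (Fp L) L (IsCMField.complexConj L) v n (hermD_eq_map_gramD L e dV hdV dW hdW) hπ
      (mem_unipDeltaLoc_iff_mem_unipDeltaLocal L e dV hdV dW hdW v) h2 ψc hψc ν]
  rfl

end OnePlace

/-! ## §3 THE LETTER (V) for every normalised Haar family -/

omit [IsCMField L] in
/-- the exponent bookkeeping of §3: `x ≤ 2^{⌈x⌉₊} ≤ N(𝔭_w)^{⌈x⌉₊}` (`2 ≤ N(𝔭_w)`, ★ `two_le_absNorm`). [folklore] -/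
theorem le_absNorm_pow_natCeil (w : HeightOneSpectrum (𝓞 L)) (x : ℝ) :
    x ≤ ((Ideal.absNorm w.asIdeal : ℕ) : ℝ) ^ ⌈x⌉₊ := by
  have h2 : (2 : ℝ) ≤ ((Ideal.absNorm w.asIdeal : ℕ) : ℝ) := by exact_mod_cast two_le_absNorm L w
  calc x ≤ (⌈x⌉₊ : ℝ) := Nat.le_ceil x
    _ ≤ (2 : ℝ) ^ ⌈x⌉₊ := by exact_mod_cast (Nat.lt_two_pow_self).le
    _ ≤ ((Ideal.absNorm w.asIdeal : ℕ) : ℝ) ^ ⌈x⌉₊ := pow_le_pow_left₀ (by norm_num) h2 _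

/-- **(V) `hvol_of_haar` — THE HAAR-VOLUME LETTER OF ★ p863720, PAID FOR EVERY HAAR FAMILY NORMALISED BY `νv v (N_Δ ∩ K_v) = 1`** (the ∃-carriers of ★
`kindW_block_cm_of_localLetters_haar` with their `hνK`; any uniformisers `π v`): there are a finite set `Tν` of places of `L`, defects `ρν` supported on `Tν` and the
UNIFORM exponent `dν = 2n²` with `νv v (kindWLocalBall v (π v) (−a)) ≤ ENNReal.ofReal ((∏_{w∣v} N(𝔭_w)^{ρν w}) · N(v)^{dν·a})` for ALL `v`, `a` — the `(Tν ρν hρν dν hvol)` slots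
of ★ `hsizeLoc_of_place`.  Off the finite set `T₂` of places with some `|2|_w ≠ 1` the ball of exponent `0` has measure `1` (§2 + `hνK`), so `ρν = 0` there; above `v ∈ T₂`,
`ρν w := ⌈(νv v (B(0))).toReal⌉₊` absorbs the finite constant. [cite: WeilBNT1967, Ch. II §4] [cite: Casselman1980, §3] [cite: Tan1999, §2] [cite: Weil1965, §37] -/
theorem hvol_of_haar [∀ v : HeightOneSpectrum (𝓞 (Fp L)), MeasurableSpace ↥(unipDeltaLoc L e dV hdV dW hdW v)]
    [∀ v : HeightOneSpectrum (𝓞 (Fp L)), BorelSpace ↥(unipDeltaLoc L e dV hdV dW hdW v)]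
    (νv : ∀ v : HeightOneSpectrum (𝓞 (Fp L)), Measure ↥(unipDeltaLoc L e dV hdV dW hdW v)) [∀ v, (νv v).IsHaarMeasure]
    (hνK : ∀ v, νv v (((inH (fun v => UnitaryGroup.localInt L (IsCMField.complexConj L) (n + n) (hermD L e dV hdV dW hdW) v)
      (fun v => unipDeltaLoc L e dV hdV dW hdW v) v) : Subgroup (unipDeltaLoc L e dV hdV dW hdW v)) : Set (unipDeltaLoc L e dV hdV dW hdW v)) = 1)
    {π : ∀ v : HeightOneSpectrum (𝓞 (Fp L)), v.adicCompletion (Fp L)} (hπ : ∀ v, Valued.v (π v) = WithZero.exp (-1 : ℤ)) :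
    ∃ (Tν : Finset (HeightOneSpectrum (𝓞 L))) (ρν : HeightOneSpectrum (𝓞 L) → ℕ) (dν : ℕ), (∀ w ∉ Tν, ρν w = 0) ∧
      ∀ (v : HeightOneSpectrum (𝓞 (Fp L))) (a : ℕ), νv v (kindWLocalBall L e dV hdV dW hdW v (π v) (-(a : ℤ))) ≤
        ENNReal.ofReal ((∏ w : UnitaryGroup.PlacesOver L v, ((Ideal.absNorm w.1.asIdeal : ℕ) : ℝ) ^ ρν w.1) *
          ((Ideal.absNorm v.asIdeal : ℕ) : ℝ) ^ (dν * a)) := by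
  obtain ⟨T₂, hT₂⟩ := exists_finset_forall_valuation_two_eq_one L
  -- the defect: `⌈νv v (B(0))⌉₊` above the places of `T₂`, `0` elsewhere
  refine ⟨T₂.biUnion (fun v => (Finset.univ : Finset (UnitaryGroup.PlacesOver L v)).map (Function.Embedding.subtype _)),
    fun w => if w.under (𝓞 (Fp L)) ∈ T₂ then ⌈(νv (w.under (𝓞 (Fp L))) (kindWLocalBall L e dV hdV dW hdW (w.under (𝓞 (Fp L))) (π (w.under (𝓞 (Fp L)))) 0)).toReal⌉₊ else 0,
    2 * (n * n), fun w hw => ?_, fun v a => ?_⟩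
  · rw [mem_biUnion_placesOver_iff] at hw
    beta_reduce
    rw [if_neg hw]
  have hq0 : ∀ w : HeightOneSpectrum (𝓞 L), (0 : ℝ) ≤ ((Ideal.absNorm w.asIdeal : ℕ) : ℝ) := fun w => Nat.cast_nonneg _
  have hgrow := measure_kindWLocalBall_neg_le L e dV hdV dW hdW v (hπ v) (νv v) a
  have hNva : (0 : ℝ) ≤ ((Ideal.absNorm v.asIdeal : ℕ) : ℝ) ^ (2 * (n * n) * a) := pow_nonneg (Nat.cast_nonneg _) _
  -- the fibre product reads `N(𝔭_w)^{ρν w}` with `w.under = v`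
  have hfib : ∀ w : UnitaryGroup.PlacesOver L v, (if w.1.under (𝓞 (Fp L)) ∈ T₂ then
      ⌈(νv (w.1.under (𝓞 (Fp L))) (kindWLocalBall L e dV hdV dW hdW (w.1.under (𝓞 (Fp L))) (π (w.1.under (𝓞 (Fp L)))) 0)).toReal⌉₊ else 0) =
      (if v ∈ T₂ then ⌈(νv v (kindWLocalBall L e dV hdV dW hdW v (π v) 0)).toReal⌉₊ else 0) := fun w => by rw [w.2]
  beta_reduce
  simp_rw [hfib]
  by_cases hv : v ∈ T₂
  · -- a place with some `|2|_w ≠ 1`: the finite constant `νv v (B(0))` is below `N(𝔭_w)^{ρν w}` for every `w ∣ v`, hence below their product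
    simp_rw [if_pos hv]
    have hfinite := measure_kindWLocalBall_ne_top L e dV hdV dW hdW v (hπ v) (νv v) 0
    set x : ℝ := (νv v (kindWLocalBall L e dV hdV dW hdW v (π v) 0)).toReal with hx
    have hprod : x ≤ ∏ w : UnitaryGroup.PlacesOver L v, ((Ideal.absNorm w.1.asIdeal : ℕ) : ℝ) ^ ⌈x⌉₊ := by
      obtain ⟨w₀⟩ := (inferInstance : Nonempty (UnitaryGroup.PlacesOver L v))
      have h1 : ∀ w : UnitaryGroup.PlacesOver L v, (1 : ℝ) ≤ ((Ideal.absNorm w.1.asIdeal : ℕ) : ℝ) ^ ⌈x⌉₊ := fun w =>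
        one_le_pow₀ (by exact_mod_cast (show 1 ≤ Ideal.absNorm w.1.asIdeal from le_trans (by norm_num) (two_le_absNorm L w.1)))
      calc x ≤ ((Ideal.absNorm w₀.1.asIdeal : ℕ) : ℝ) ^ ⌈x⌉₊ := le_absNorm_pow_natCeil L w₀.1 x
        _ = ∏ w ∈ ({w₀} : Finset (UnitaryGroup.PlacesOver L v)), ((Ideal.absNorm w.1.asIdeal : ℕ) : ℝ) ^ ⌈x⌉₊ := by rw [Finset.prod_singleton]
        _ ≤ ∏ w : UnitaryGroup.PlacesOver L v, ((Ideal.absNorm w.1.asIdeal : ℕ) : ℝ) ^ ⌈x⌉₊ :=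
          Finset.prod_le_prod_of_subset_of_one_le (Finset.subset_univ _) (fun w _ => zero_le_one.trans (h1 w)) fun w _ _ => h1 w
    calc νv v (kindWLocalBall L e dV hdV dW hdW v (π v) (-(a : ℤ)))
        ≤ ENNReal.ofReal (((Ideal.absNorm v.asIdeal : ℕ) : ℝ) ^ (2 * (n * n) * a)) * νv v (kindWLocalBall L e dV hdV dW hdW v (π v) 0) := hgrow
      _ = ENNReal.ofReal (((Ideal.absNorm v.asIdeal : ℕ) : ℝ) ^ (2 * (n * n) * a)) * ENNReal.ofReal x := by rw [hx, ENNReal.ofReal_toReal hfinite]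
      _ ≤ ENNReal.ofReal (((Ideal.absNorm v.asIdeal : ℕ) : ℝ) ^ (2 * (n * n) * a)) *
            ENNReal.ofReal (∏ w : UnitaryGroup.PlacesOver L v, ((Ideal.absNorm w.1.asIdeal : ℕ) : ℝ) ^ ⌈x⌉₊) :=
          mul_le_mul_right (ENNReal.ofReal_le_ofReal hprod) _
      _ = ENNReal.ofReal ((∏ w : UnitaryGroup.PlacesOver L v, ((Ideal.absNorm w.1.asIdeal : ℕ) : ℝ) ^ ⌈x⌉₊) *
            ((Ideal.absNorm v.asIdeal : ℕ) : ℝ) ^ (2 * (n * n) * a)) := by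
          rw [← ENNReal.ofReal_mul hNva, mul_comm]
  · -- a place with `|2|_w = 1` for all `w ∣ v`: `νv v (B(0)) = νv v (N_Δ ∩ K_v) = 1`, no defect
    simp_rw [if_neg hv, pow_zero, Finset.prod_const_one, one_mul]
    rw [measure_kindWLocalBall_zero_eq L e dV hdV dW hdW v (hπ v) (νv v) (hT₂ v hv), hνK v, mul_one] at hgrow
    exact hgrow

end Summit.HodgeConjecture.HodgeConjecture.Cruxes.HLiu418.K2LiuKindWCarrierHaarVolume

end
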